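import Literature.Computability.Complexity.TM2Iterate
import HarnessLib

/-!
# Clocked iteration with an explicit size bound on the iterates

Trunk `CplxCore`, a complement to `TM2Iterate.lean`. There, the loop machine `TM2Iter.iterTM`
of a polynomial-time machine `Mx` computing `F : α → α` is shown to compute the clocked
iteration `(a, n) ↦ F^[n] a` in polynomial time *provided the iterates grow at most linearly*
(`TM2Iter.iterAux_outputsWithin`, hypothesis `|ea (F^[n] a)| ≤ d (|ea a| + n)`). The main loop
lemma `TM2Iter.loop_run` is, however, valid for an arbitrary bound `B` on the iterates; this
file records the resulting running time of the whole loop machine in that generality: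

* `TM2Iter.iterAux_outputsWithin_of_le`: if `|ea (F^[i] a)| ≤ B` for all `i ≤ n`, then on input
  `replicate n none ++ (ea a).map some` the loop machine halts with output `ea (F^[n] a)` within
  `2 |ea a| + n + 4 + n · (2B + 3 + p B)` steps.

This is the form needed when the iterated map doubles its input (exhaustive-search machines,
`Literature/Computability/FineGrained/`): the bound `B` is then exponential in `n`, and the
running time is polynomial in `B`, which is all that exponential-time upper bounds require.

## References

* S. Arora, B. Barak, *Computational Complexity: A Modern Approach*, CUP 2009, §1.4.1
  (universal TM with time bound: the step counter), §1.3.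
-/

namespace Literature.Computability.Complexity

namespace TM2Iter

open Turing StateTransition Function

variable {α A : Type} [Inhabited A] {ea : α → List A} {F : α → α}
  (Mx : TM2ComputableAux A A) (p : Polynomial ℕ)
  (hF : ∀ a, Mx.OutputsWithin (ea a) (ea (F a)) (p.eval (ea a).length))

include hF in
/-- **Running time of the loop machine under an explicit size bound.** If all iterates
`ea (F^[i] a)`, `i ≤ n`, have length at most `B`, then on input
`replicate n none ++ (ea a).map some` the loop machine `iterAux Mx` halts with output
`ea (F^[n] a)` within `2 |ea a| + n + 4 + n · (2B + 3 + p B)` steps: `n + |ea a| + 1` steps to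
sort the input into counter and data, `|ea a| + 1` to lay the data on the output stack of `Mx`,
then `n` rounds of `2B + 3 + p B` steps and `2` final steps (`loop_run`).
[cite: AroraBarak2009, §1.4.1 (universal TM with time bound)] -/
theorem iterAux_outputsWithin_of_le (a : α) (n B : ℕ)
    (hB : ∀ i ≤ n, (ea (F^[i] a)).length ≤ B) :
    (iterAux Mx).OutputsWithin (List.replicate n none ++ (ea a).map some) (ea (F^[n] a))
      (2 * (ea a).length + n + 4 + n * (2 * B + 3 + p.eval B)) := by
  apply outputsWithin_of_reachesIn
  have hin : (List.replicate n none ++ (ea a).map some).map (iterAux Mx).inputAlphabet.symm =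
      List.replicate n none ++ (ea a).map some := List.map_id _
  rw [hin]
  change ReachesIn (C := LCfg Mx.tm A) (iterTM Mx.tm Mx.inputAlphabet Mx.outputAlphabet).step
    (initList (iterTM Mx.tm Mx.inputAlphabet Mx.outputAlphabet) _)
    (haltList (iterTM Mx.tm Mx.inputAlphabet Mx.outputAlphabet)
      ((ea (F^[n] a)).map Mx.outputAlphabet.symm)) _
  rw [initList_iterTM, haltList_iterTM]
  have h1 := init1_cnt Mx.tm Mx.inputAlphabet Mx.outputAlphabet Mx.tm.initialState (fun _ => [])
    n ((ea a).map some) [] []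
  have h2 := init1_data Mx.tm Mx.inputAlphabet Mx.outputAlphabet Mx.tm.initialState (fun _ => [])
    (ea a) [] [] (List.replicate n () ++ [])
  have h2' := ReachesIn.single (step_init1_nil Mx.tm Mx.inputAlphabet Mx.outputAlphabet
    Mx.tm.initialState (fun _ => []) ((ea a).reverse ++ []) (List.replicate n () ++ []))
  have h3 := init2_run Mx.tm Mx.inputAlphabet Mx.outputAlphabet Mx.tm.initialState (fun _ => [])
    [] ((ea a).reverse ++ []) (List.replicate n () ++ [])
  simp only [List.append_nil, List.reverse_reverse, List.length_reverse] at h1 h2 h2' h3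
  have h4 := loop_run Mx p hF a B n 0 (fun i hi => hB i (by omega))
  rw [iterate_zero_apply, Nat.zero_add] at h4
  have := (((h1.trans h2).trans h2').trans h3).trans h4
  refine this.mono ?_
  omega

omit [Inhabited A] in
/-- The iterates of a map that at most doubles lengths (up to an additive constant `e`):
`|ea (F a)| ≤ 2 |ea a| + e` gives `|ea (F^[i] a)| + e ≤ 2 ^ i · (|ea a| + e)`. [folklore] -/
theorem length_iterate_le_two_pow {e : ℕ} (hd : ∀ a, (ea (F a)).length ≤ 2 * (ea a).length + e)
    (a : α) (i : ℕ) : (ea (F^[i] a)).length + e ≤ 2 ^ i * ((ea a).length + e) := by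
  induction i with
  | zero => simp
  | succ i ih =>
    rw [iterate_succ_apply', pow_succ]
    have := hd (F^[i] a)
    calc (ea (F (F^[i] a))).length + e ≤ 2 * ((ea (F^[i] a)).length + e) := by omega
      _ ≤ 2 * (2 ^ i * ((ea a).length + e)) := Nat.mul_le_mul_left 2 ih
      _ = 2 ^ i * 2 * ((ea a).length + e) := by ring

end TM2Iter

end Literature.Computability.Complexity
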